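import Literature.AlgebraicGeometry.ModuliOfAbelianVarieties.SiegelFineModuliSchemeOfRepresentedCharts
import Literature.AlgebraicGeometry.ModuliOfAbelianVarieties.SiegelModuliFrameSubfunctor
import Literature.AlgebraicGeometry.ModuliOfAbelianVarieties.SiegelLinearRigidificationUnique
import Literature.AlgebraicGeometry.AbelianSchemes.PolarizedLevelLocallyRigidifiable
import HarnessLib

/-!
# A fine moduli scheme from STANDARD-FRAME SLICES — the open sub-functors ARE Mumford's frame conditions `𝓕_R`
# ([MumfordFogartyKirwan1994] Prop. 7.6 with the open-sub-functor clause DISCHARGED by ★ `SiegelModuliFrameSubfunctor`)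

Layer `Literature/AlgebraicGeometry/ModuliOfAbelianVarieties`; THEOREMS ONLY (no definition, no named fact, no instance, no notation,
no `sorry`).  Cell `hodgecm-mathlib` (D-0151), F-8 (8ε) FILE 2B, first half (B-p08 (g13); sequencer B-plan1 (g16)/(g17)).
HC_CM is proved only modulo the 7 printed citations until rung 0 closes; nothing here is about HC.

★ (8ε) FILE 2A `exists_siegelFineModuliScheme_of_representedCharts` produces a fine moduli scheme from ABSTRACT open conditions
`Fr`/`frOpen` with the ℚ-relative open-sub-functor clause `hFr`.  THIS FILE takes `Fr P R := IsFrameOn J P (tup R)` — «the `R`-marked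
`N`-torsion sections are a projective frame through every local linear rigidification» ([MumfordFogartyKirwan1994] Ch. 3 §1 Def. 3.3 /
Ch. 7 §2 Prop. 7.6, ★ (8α) `SiegelFramedCovariant` §4) — and DISCHARGES `hFr` by ★ (8β-b)
`PolarizedAbelianSchemeWithLevel.isFrameOn_iff_preimage_frameOpen_eq_top` (the frame condition is an open sub-functor over locally
Noetherian ℚ-schemes) fed with ★ (hLR) `exists_openCover_isFrameRigidification` (every triple over a locally Noetherian ℚ-scheme is
Zariski-locally linearly rigidified — `π_*(L^Δ(λ)³)` is locally free of rank `6^g d = #J + 1`, [MumfordFogartyKirwan1994] Def. 7.5)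
and ★ (U-b) `exists_openCover_GL_of_isLinearRigidification` (two linear rigidifications differ Zariski-locally by `GL_{m+1}`,
B-p01 (g14)) for ★ (8β-b)'s GL-comparison input.  What remains abstract is exactly the SLICE DATA of (8γ): the slices `V R` over ℚ with their `R`-framed
(`huniv`), projective (`hprojV`) universal triples `ZV R` representing `𝓕_R` (`hrep`), the F-3 inputs (`hdual` in the letter of record,
`unitV`), and the covering hypothesis `hcov` of [MumfordFogartyKirwan1994] Prop. 7.7.

## References
* [MumfordFogartyKirwan1994] D. Mumford, J. Fogarty, F. Kirwan, *Geometric Invariant Theory*, 3rd ed. (1994), Ch. 3 §1 Def. 3.3 and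
  Prop. 3.1 (p. 68), Ch. 7 §2 Def. 7.5 (p. 130), Prop. 7.6 (p. 136; proof pp. 136–138), Prop. 7.7 (p. 138), §3 Thm. 7.9 (p. 139).
* [Deligne1971TravauxShimura] P. Deligne, *Travaux de Shimura*, Sém. Bourbaki 389 (1971), 4.16 (p. 150).
-/

noncomputable section

-- the `Over`-category structure maps of ★ `baseChange` are not reducible (as in ★ `SiegelModuliOfOpenCharts`).
set_option backward.isDefEq.respectTransparency false

open CategoryTheory CategoryTheory.Limits AlgebraicGeometry TopologicalSpace
open Literature.AlgebraicGeometry.AbelianSchemes Literature.AlgebraicGeometry.Motives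
open Literature.AlgebraicGeometry.Morphisms (IsProjective intU projectiveSpaceInt isPullback_projToSpec_projMap_terminal)
open Literature.AlgebraicGeometry.GroupSchemes.GeneralLinearGroupScheme (intCast actCore)

namespace Literature.AlgebraicGeometry.ModuliOfAbelianVarieties

open PolarizedAbelianSchemeWithLevel AbelianSchemeOver

variable {g N : ℕ} {δ : Fin g → ℕ}

/-- **[MumfordFogartyKirwan1994] Prop. 7.6 — A FINE MODULI SCHEME FROM STANDARD-FRAME SLICES.**  For `N ≥ 3`, a polarization type `δ`,
homogeneous coordinates indexed by `J` with `#J + 1 = 6^g · d` (the rank of `π_*(L^Δ(λ)³)`), a family of `R`-tuples `tup R` of exponent vectors (`R : ι`) such that every triple over an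
algebraically closed field OVER ℚ is `tup R`-framed for some `R` (`hcov`, [MumfordFogartyKirwan1994] Prop. 7.7), and SLICES: locally
Noetherian ℚ-schemes `V R` with triples `ZV R` that are `tup R`-framed (`huniv`), projective (`hprojV`) and REPRESENT the frame
condition `𝓕_{tup R}` (`hrep`: every `tup R`-framed triple over a locally Noetherian ℚ-scheme is the pull-back of `ZV R` along a
unique morphism to `V R` — the slice theorem (8γ)), together with the F-3 inputs `hdual` (dual pairs for abelian schemes that are
Zariski-locally pull-backs of projective ones) and `unitV`: THERE IS a fine moduli scheme `𝓜 : SiegelFineModuliScheme g N δ` covered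
by open immersions `j R : V R ↪ 𝓜.M` over ℚ along which `𝓜.univ` restricts to `ZV R`, the charts overlapping exactly along the frame
opens `U_{tup R}`.  ★ FILE 2A with `Fr P R := IsFrameOn J P (tup R)`, the open-sub-functor clause by ★
`isFrameOn_iff_preimage_frameOpen_eq_top` + ★ `exists_openCover_isFrameRigidification` + ★ `exists_openCover_GL_of_isLinearRigidification`.
[cite: MumfordFogartyKirwan1994, Ch. 7 §2 Proposition 7.6 (p. 136; proof pp. 136–138)]
[cite: MumfordFogartyKirwan1994, Ch. 3 §1 Definition 3.3 (p. 68)] [cite: MumfordFogartyKirwan1994, Ch. 7 §2 Def. 7.5 (p. 130)]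
[cite: Deligne1971TravauxShimura, 4.16 p. 150] -/
theorem exists_siegelFineModuliScheme_of_frameSlices (J : Type) [Finite J] (hJ : Nat.card J + 1 = 6 ^ g * polarizationDegree δ)
    (hN : 3 ≤ N) (hδ : IsPolarizationType δ)
    {ι : Type} (tup : ι → (Fin (Nat.card J + 2) → (Fin g ⊕ Fin g → ZMod N)))
    (hcov : ∀ ⦃Ω : Type⦄ [Field Ω] [IsAlgClosed Ω] (_ : Spec (.of Ω) ⟶ Spec (.of ℚ))
      (Q : PolarizedAbelianSchemeWithLevel g N δ (Spec (.of Ω))), ∃ R, IsFrameOn J Q (tup R))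
    (V : ι → Scheme.{0}) [∀ R, IsLocallyNoetherian (V R)] (fV : ∀ R, V R ⟶ Spec (.of ℚ))
    (ZV : ∀ R, PolarizedAbelianSchemeWithLevel g N δ (V R)) (huniv : ∀ R, IsFrameOn J (ZV R) (tup R))
    (hrep : ∀ R ⦃T : Scheme.{0}⦄ [IsLocallyNoetherian T] (_fT : T ⟶ Spec (.of ℚ))
      (P' : PolarizedAbelianSchemeWithLevel g N δ T), IsFrameOn J P' (tup R) →
      ∃! v : T ⟶ V R, ∃ (G : P'.A.X.left ⟶ (ZV R).A.X.left) (Ĝ : P'.D.hat.X.left ⟶ (ZV R).D.hat.X.left),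
        P'.IsBaseChangeVia (ZV R) v G Ĝ)
    (hprojV : ∀ R, IsProjective (ZV R).A.X.hom)
    (hdual : ∀ ⦃S : Scheme.{0}⦄ [IsLocallyNoetherian S] (_fS : S ⟶ Spec (.of ℚ)) (A : AbelianSchemeOver S),
      (∀ s : S, ∃ (U : Scheme.{0}) (i : U ⟶ S) (_ : IsOpenImmersion i) (_ : s ∈ Set.range i.base)
        (B : AbelianSchemeOver U) (G : B.X.left ⟶ A.X.left), B.IsBaseChangeVia A i G ∧ IsProjective B.X.hom) →
      Nonempty A.DualPair)
    (unitV : ∀ R, Nonempty ((Scheme.Modules.pullback (DualPair.unitHatSlice (ZV R).D)).obj (ZV R).D.P ≅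
      SheafOfModules.unit _)) :
    ∃ (𝓜 : SiegelFineModuliScheme g N δ) (j : ∀ R, V R ⟶ 𝓜.M.left) (_ : ∀ R, IsOpenImmersion (j R))
      (_ : ∀ R, j R ≫ 𝓜.M.hom = fV R)
      (Gc : ∀ R, (ZV R).A.X.left ⟶ 𝓜.univ.A.X.left) (Ĝc : ∀ R, (ZV R).D.hat.X.left ⟶ 𝓜.univ.D.hat.X.left),
      (∀ R, (ZV R).IsBaseChangeVia 𝓜.univ (j R) (Gc R) (Ĝc R)) ∧
      (∀ R R', (j R') ⁻¹ᵁ (j R).opensRange = frameOpen J (ZV R') (tup R)) ∧ (⨆ R, (j R).opensRange = ⊤) :=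
  exists_siegelFineModuliScheme_of_representedCharts hN hδ (fun _ P R => IsFrameOn J P (tup R))
    (fun _ P R => frameOpen J P (tup R))
    (fun _ _ _ _ fT _ P' _ _ _ _ h R =>
      isFrameOn_iff_preimage_frameOpen_eq_top J P' (tup R) (fun _ _ Q κ κ' hκ hκ' =>
          exists_openCover_GL_of_isLinearRigidification (J := J) Q κ κ' hκ hκ') h
        (exists_openCover_isFrameRigidification fT P' J hJ))
    V fV ZV huniv hrep hprojV hdual unitV hcov

end Literature.AlgebraicGeometry.ModuliOfAbelianVarieties

end
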